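/-
Copyright (c) 2026. All rights reserved.
Released under Apache 2.0 license as described in the file LICENSE.
Authors: abc-iut cell, prover seat abc-iut-L4-t12 (gen 7).
-/
import Literature.AnabelianGeometry.AbsoluteAnabelian.ArchimedeanHolFieldFunctorGeometricCovFin
import Literature.AnabelianGeometry.AbsoluteAnabelian.IdRigidLocalCriterion
import Mathlib.CategoryTheory.Comma.Over.Basic
import HarnessLib

/-!
# [AbsTopIII] Prop 4.2 (i), geometric column: id-rigidity of «objects mapping to `𝕏`» from the slice

PROOF-ONLY reduction file (abc-iut cell, campaign-L item R1.2 of the `EA` column of [AbsTopIII]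
Prop 4.2 / Cor 4.5; classical category theory).  S. Mochizuki, *Topics in Absolute Anabelian Geometry
III*, proof of Prop 4.2 (i), kurims p.106 l.11–19:

> To verify the id-rigidity of `EA`, it suffices to observe that for any object `X ∈ Ob(EA)` … the
> full subcategory of `EA` consisting of objects that map to `X` may … be identified with the category
> of finite étale R-localizations `Loc_R(X)` … Thus, the id-rigidity of `EA` follows immediately from
> the slimness assertion of Lemma 4.3 below.

abc-iut-L4-t14's criterion `isIdRigid_of_forall_isIdRigid_mapsTo` (IdRigidLocalCriterion.lean) turns
print's sentence into: `EA` is id-rigid as soon as every full subcategory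
`{Y | Nonempty (Y ⟶ X)}` is.  This file splits THAT hypothesis, for a fixed `X`, into two honest pieces
and discharges the second at the geometric model:

* `isIdRigid_iff_of_equivalence_univ` — id-rigidity is invariant under an equivalence of categories
  living in DIFFERENT universes (the tree's `isIdRigid_of_equivalence` wants equal universe levels; the slice
  `Over 𝕏` of `HolRS` has `Hom`s in `Type 1`, the covering categories `CovFin` in `Type 0`);
* `isIdRigid_mapsTo_of_over` — **for any category `C` and object `X`: if (H1) every automorphism of
  `X` commuting with all endomorphisms of `X` is the identity, and (H2) the SLICE `Over X` is id-rigid,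
  then the full subcategory `{Y | Nonempty (Y ⟶ X)}` is id-rigid** (an automorphism `α` of its
  identity functor has `α_X` commuting with `End X`, so `α_X = 𝟙` by (H1); then every `α_Y` is a
  morphism OVER `X` by naturality along `Y ⟶ X`, i.e. `α` restricts to an automorphism of `𝟭_{Over X}`,
  trivial by (H2));
* `ObjectProperty.overFullSubcategoryEquiv` — for a full subcategory `P` closed DOWNWARDS along
  morphisms (`Y ⟶ Z`, `P Z ⇒ P Y`; e.g. `P = ⊤`, or «hyperbolic» for finite étale covers), the slice of
  `P.FullSubcategory` over `X` is equivalent to the slice of `C` over `X.obj`;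
* `HolRS.isIdRigid_over_of_isIdRigid_connectedCover` — **(H2) at the geometric model**: the slice of
  `HolRS` over `𝕏` is id-rigid as soon as the category of CONNECTED finite covering spaces of `𝕏^top`
  is (transport along `HolRS.overEquivConnectedCovFin`, p434602) — the latter is the cell's (3ε)
  «`Aut(𝟭) ≅ Z(π̂₁)` on connected covers» (abc-iut-L6-t18, `CoveringConnectedIdRigid.lean`), so (H2)
  holds whenever `Z(π̂₁(𝕏^top)) = 1`, unconditionally for `ℂ ∖ F`, `2 ≤ |F| < ∞`;
* `HolRS.isIdRigid_mapsTo_of_connectedCover` — the two pieces assembled in the shape consumed by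
  `HolRS.isIdRigid_EA_of_forall_isIdRigid_mapsTo`: for `Q` closed downwards under holomorphic finite
  étale maps and `𝕏 ∈ Q`, (H1 for `𝕏` in `HolRS`) + (connected finite covers of `𝕏^top` id-rigid) ⇒
  «objects of `EA(Q)` mapping to `𝕏`» is id-rigid.

HONEST RESIDUAL, per object `𝕏`: (H1) «a biholomorphic automorphism of `𝕏` commuting with every
holomorphic finite étale endomorphism of `𝕏` is the identity» (for `ℙ¹ ∖ {0,1,∞}`: `Aut = 𝔖₃` is
centre-free — needs the classification of its automorphisms, not in the tree) and
`Z(π̂₁(𝕏^top)) = 1`; print instead invokes Lemma 4.3 (slimness of `Π` of the CORE `[X / Aut X]`),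
which is abc-iut-L4-t14's `LocCategoryGroupModel` route.  Nothing here bears on [IUTchIII] Cor. 3.12;
model ≠ reconstruction; a support lemma is not a node.

## References

* S. Mochizuki, *Topics in Absolute Anabelian Geometry III*, kurims ms, §0 p.27 (id-rigid), proof of
  Prop 4.2 (i) p.106 l.11–19. [MochizukiAbsTopIII2015]
-/

noncomputable section

open CategoryTheory

namespace Literature.AnabelianGeometry.AbsoluteAnabelian

universe v u v' u'

/-! ### §0 Id-rigidity along an equivalence across universes -/

section Univ

variable {C : Type u} [Category.{v} C] {D : Type u'} [Category.{v'} D]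

/-- One direction of `isIdRigid_iff_of_equivalence_univ` (heterogeneous universes).
[cite: MochizukiAbsTopIII2015, Section 0 p.27] -/
private theorem isIdRigid_of_equivalence_univ_aux (e : C ≌ D) (hD : IsIdRigid D) : IsIdRigid C := by
  refine isRigidFunctor_of_hom_app_eq_id fun α c => ?_
  let W : e.inverse ⋙ e.functor ≅ e.inverse ⋙ e.functor :=
    Functor.isoWhiskerRight (Functor.isoWhiskerLeft e.inverse α) e.functor
  have hβ : e.counitIso.symm ≪≫ W ≪≫ e.counitIso = Iso.refl _ := hD _
  have hW : W = Iso.refl _ := by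
    have : W = e.counitIso ≪≫ (e.counitIso.symm ≪≫ W ≪≫ e.counitIso) ≪≫ e.counitIso.symm := by
      simp only [Iso.trans_assoc, Iso.self_symm_id, Iso.trans_refl, Iso.self_symm_id_assoc]
    rw [this, hβ, Iso.refl_trans, Iso.self_symm_id]
  have hG : ∀ d : D, α.hom.app (e.inverse.obj d) = 𝟙 _ := fun d => by
    have h := congrArg (fun t => t.hom.app d) hW
    simp only [W, Functor.isoWhiskerRight_hom, Functor.isoWhiskerLeft_hom, Functor.whiskerRight_app,
      Functor.whiskerLeft_app, Iso.refl_hom, NatTrans.id_app] at h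
    apply e.functor.map_injective
    rw [CategoryTheory.Functor.map_id]
    exact h
  have nat := α.hom.naturality (e.unitIso.hom.app c)
  have hc : α.hom.app ((e.functor ⋙ e.inverse).obj c) = 𝟙 _ := hG (e.functor.obj c)
  rw [hc] at nat
  have key : α.hom.app c ≫ e.unitIso.hom.app c = 𝟙 _ ≫ e.unitIso.hom.app c := by
    have h := nat.symm
    simp only [Functor.id_obj, Functor.id_map, Category.comp_id, Category.id_comp] at h ⊢
    exact h
  exact (cancel_mono (e.unitIso.hom.app c)).1 key

/-- **Id-rigidity is invariant under equivalence of categories, across universes**: for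
`e : C ≌ D` with `C` and `D` in possibly DIFFERENT universes, `C` is id-rigid iff `D` is (an
automorphism of `𝟭_C` conjugates through `e.inverse ⋙ e.functor ≅ 𝟭_D` to one of `𝟭_D`; `e.functor` is
faithful and the unit is a natural isomorphism).  The tree's `isIdRigid_of_equivalence` /
`isIdRigid_of_equivalence'` are the two directions under the restriction `C D : Type u`,
`Category.{v}`; the slice `Over 𝕏` of `HolRS` (`Hom`s in `Type 1`) versus the covering categories
`CovFin` (`Hom`s in `Type 0`) needs the heterogeneous form. [cite: MochizukiAbsTopIII2015, Section 0 p.27] -/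
theorem isIdRigid_iff_of_equivalence_univ (e : C ≌ D) : IsIdRigid C ↔ IsIdRigid D :=
  ⟨isIdRigid_of_equivalence_univ_aux e.symm, isIdRigid_of_equivalence_univ_aux e⟩

end Univ

/-! ### §1 «Objects mapping to `X`» is id-rigid ⇐ (H1) at `X` + (H2) the slice over `X` -/

section MapsTo

variable {C : Type u} [Category.{v} C] (X : C)

/-- The object `X` of the full subcategory of objects mapping to `X` (via `𝟙_X`).
[cite: MochizukiAbsTopIII2015, Proposition 4.2 (i) p.106] -/
abbrev mapsToSelf : ObjectProperty.FullSubcategory fun Y : C => Nonempty (Y ⟶ X) :=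
  ⟨X, mapsTo_self X⟩

/-- For an automorphism `α` of the identity functor of `{Y | Nonempty (Y ⟶ X)}`, the component at
`X` commutes with every endomorphism of `X`. [cite: MochizukiAbsTopIII2015, Section 0 p.27] -/
theorem app_self_comm
    (α : 𝟭 (ObjectProperty.FullSubcategory fun Y : C => Nonempty (Y ⟶ X)) ≅ 𝟭 _) (u : X ⟶ X) :
    (α.hom.app (mapsToSelf X)).hom ≫ u = u ≫ (α.hom.app (mapsToSelf X)).hom := by
  have h := α.hom.naturality (X := mapsToSelf X) (Y := mapsToSelf X) (ObjectProperty.homMk u)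
  have h' := congrArg InducedCategory.Hom.hom h
  simp only [Functor.id_obj, Functor.id_map, ObjectProperty.FullSubcategory.comp_hom,
    ObjectProperty.homMk_hom] at h'
  exact h'.symm

/-- For an automorphism `α` of the identity functor of `{Y | Nonempty (Y ⟶ X)}` with trivial
`X`-component, every component `α_Y` is a morphism OVER `X` along any `f : Y ⟶ X`.
[cite: MochizukiAbsTopIII2015, Section 0 p.27] -/
theorem app_over
    (α : 𝟭 (ObjectProperty.FullSubcategory fun Y : C => Nonempty (Y ⟶ X)) ≅ 𝟭 _)
    (hX : (α.hom.app (mapsToSelf X)).hom = 𝟙 X) {Y : C} (f : Y ⟶ X) :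
    (α.hom.app ⟨Y, ⟨f⟩⟩).hom ≫ f = f := by
  have h := α.hom.naturality (X := ⟨Y, ⟨f⟩⟩) (Y := mapsToSelf X) (ObjectProperty.homMk f)
  have h' := congrArg InducedCategory.Hom.hom h
  simp only [Functor.id_obj, Functor.id_map, ObjectProperty.FullSubcategory.comp_hom,
    ObjectProperty.homMk_hom] at h'
  rw [hX, Category.comp_id] at h'
  exact h'.symm

/-- **«Objects mapping to `X`» is id-rigid from (H1) + (H2).**  (H1): every automorphism of `X`
commuting with all endomorphisms of `X` is the identity; (H2): the slice `Over X` is id-rigid.  Then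
the full subcategory `{Y | Nonempty (Y ⟶ X)}` of `C` is id-rigid: for an automorphism `α` of its
identity functor, `α_X` commutes with `End X` (naturality), so `α_X = 𝟙` by (H1); then each `α_Y` is
a morphism over `X` (naturality along `Y ⟶ X`), and `Y/X ↦ α_Y` is an automorphism of `𝟭_{Over X}`,
trivial by (H2). [cite: MochizukiAbsTopIII2015, Proposition 4.2 (i) p.106] -/
theorem isIdRigid_mapsTo_of_over
    (h1 : ∀ a : X ≅ X, (∀ u : X ⟶ X, a.hom ≫ u = u ≫ a.hom) → a.hom = 𝟙 X)
    (h2 : IsIdRigid (Over X)) :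
    IsIdRigid (ObjectProperty.FullSubcategory fun Y : C => Nonempty (Y ⟶ X)) := by
  refine isRigidFunctor_of_hom_app_eq_id fun α Y => ?_
  -- (H1): the component at `X` is the identity
  have hX : (α.hom.app (mapsToSelf X)).hom = 𝟙 X :=
    h1 ((ObjectProperty.ι _).mapIso (α.app (mapsToSelf X))) (app_self_comm X α)
  -- the restriction of `α` to the slice
  let β : 𝟭 (Over X) ≅ 𝟭 (Over X) :=
    NatIso.ofComponents
      (fun B => Over.isoMk ((ObjectProperty.ι _).mapIso (α.app ⟨B.left, ⟨B.hom⟩⟩))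
        (app_over X α hX B.hom))
      (fun {B B'} g => by
        ext
        have h := α.hom.naturality (X := ⟨B.left, ⟨B.hom⟩⟩) (Y := ⟨B'.left, ⟨B'.hom⟩⟩)
          (ObjectProperty.homMk g.left)
        have h' := congrArg InducedCategory.Hom.hom h
        simp only [Functor.id_obj, Functor.id_map, ObjectProperty.FullSubcategory.comp_hom,
          ObjectProperty.homMk_hom] at h'
        simpa using h')
  -- (H2): `β` is trivial, hence so is `α_Y`
  obtain ⟨f⟩ := Y.property
  have hB : β.hom.app (Over.mk f) = 𝟙 _ := h2.hom_app_eq_id β (Over.mk f)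
  have hB' : (α.hom.app ⟨Y.obj, ⟨f⟩⟩).hom = 𝟙 Y.obj := by
    have h := congrArg (fun k => Over.Hom.left k) hB
    simp only [β, NatIso.ofComponents_hom_app, Over.isoMk_hom_left, Functor.mapIso_hom,
      ObjectProperty.ι_map, Iso.app_hom, Functor.id_obj, Over.id_left] at h
    exact h
  apply ObjectProperty.hom_ext
  exact hB'

end MapsTo

/-! ### §2 The slice of a downward-closed full subcategory -/

section OverFullSubcategory

variable {C : Type u} [Category.{v} C] (P : ObjectProperty C)
  (hP : ∀ {Y Z : C}, (Y ⟶ Z) → P Z → P Y) (X : P.FullSubcategory)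

/-- For a full subcategory closed downwards along morphisms, the functor from the slice of
`P.FullSubcategory` over `X` to the slice of `C` over `X.obj` (forget the property).
[cite: MochizukiAbsTopIII2015, Section 0 p.27] -/
@[simps]
def ObjectProperty.overFullSubcategoryFunctor : Over X ⥤ Over X.obj where
  obj B := Over.mk B.hom.hom
  map g := Over.homMk g.left.hom (by
    have h := congrArg InducedCategory.Hom.hom (Over.w g)
    simp only [ObjectProperty.FullSubcategory.comp_hom] at h
    exact h)

/-- The inverse functor: a `C`-object over `X.obj` lies in `P` by downward closure.
[cite: MochizukiAbsTopIII2015, Section 0 p.27] -/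
@[simps]
def ObjectProperty.overFullSubcategoryInverse : Over X.obj ⥤ Over X where
  obj B := Over.mk (Y := (⟨B.left, hP B.hom X.property⟩ : P.FullSubcategory)) (ObjectProperty.homMk B.hom)
  map g := Over.homMk (ObjectProperty.homMk g.left) (by
    apply ObjectProperty.hom_ext
    simp only [Over.mk_hom, ObjectProperty.FullSubcategory.comp_hom, ObjectProperty.homMk_hom]
    exact Over.w g)

/-- **The slice of a downward-closed full subcategory over `X` is equivalent to the slice of the
ambient category over `X.obj`.** [cite: MochizukiAbsTopIII2015, Section 0 p.27] -/
def ObjectProperty.overFullSubcategoryEquiv : Over X ≌ Over X.obj where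
  functor := ObjectProperty.overFullSubcategoryFunctor P X
  inverse := ObjectProperty.overFullSubcategoryInverse P hP X
  unitIso := NatIso.ofComponents (fun B => Over.isoMk (Iso.refl _) (by
      apply ObjectProperty.hom_ext
      exact Category.id_comp _))
    (fun g => by
      ext
      exact (Category.comp_id _).trans (Category.id_comp _).symm)
  counitIso := NatIso.ofComponents (fun B => Over.isoMk (Iso.refl _) (Category.id_comp _))
    (fun g => by
      ext
      exact (Category.comp_id _).trans (Category.id_comp _).symm)
  functor_unitIso_comp B := by
    ext
    exact Category.id_comp _

end OverFullSubcategory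

/-! ### §3 The geometric model: (H2) from the connected finite covers of `𝕏^top` -/

namespace HolRS

open Literature.Topology.CoveringSpaces

/-- **(H2) at the geometric model**: the slice of `HolRS` over `𝕏` is id-rigid as soon as the category
of connected finite covering spaces of `𝕏^top` (continuous maps over `𝕏^top`) is id-rigid —
transport along `HolRS.overEquivConnectedCovFin 𝕏 : Over 𝕏 ≌ {connected objects of CovFin 𝕏^top}`.
(The hypothesis is the cell's «`Aut(𝟭)` of connected finite covers `≅ Z(π̂₁(𝕏^top))`», so it holds
whenever that centre is trivial, e.g. for `ℂ ∖ F`, `2 ≤ |F| < ∞`.)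
[cite: MochizukiAbsTopIII2015, Proposition 4.2 (i) p.106] -/
theorem isIdRigid_over_of_isIdRigid_connectedCover (X : HolRS)
    (h : IsIdRigid (IsConnectedCover X.carrier).FullSubcategory) : IsIdRigid (Over X) :=
  (isIdRigid_iff_of_equivalence_univ X.overEquivConnectedCovFin).2 h

/-- `Q ⊆ HolRS` is **closed under finite étale covers**: if `𝕐 → ℤ` is a morphism of `HolRS` and
`ℤ ∈ Q` then `𝕐 ∈ Q` (e.g. `Q = ⊤`; the hyperbolic Riemann surfaces). [cite: MochizukiAbsTopIII2015, Definition 4.1 (iii) p.103] -/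
def IsCoverClosed (Q : ObjectProperty HolRS) : Prop := ∀ {Y Z : HolRS}, (Y ⟶ Z) → Q Z → Q Y

/-- `⊤` is closed under finite étale covers. [cite: MochizukiAbsTopIII2015, Definition 4.1 (iii) p.103] -/
theorem isCoverClosed_top : IsCoverClosed ⊤ := fun _ _ => trivial

/-- **«Objects of `EA(Q)` mapping to `𝕏`» is id-rigid from (H1) at `𝕏` and the id-rigidity of the
connected finite covers of `𝕏^top`**, for `Q` closed under finite étale covers: the shape consumed, for
every `𝕏`, by `HolRS.isIdRigid_EA_of_forall_isIdRigid_mapsTo`.  Residual inputs, both explicit: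
(H1) an automorphism of `𝕏` commuting with all holomorphic finite étale endomorphisms of `𝕏` is the
identity; (3ε) the category of connected finite covering spaces of `𝕏^top` is id-rigid
(`⟸ Z(π̂₁(𝕏^top)) = 1`).  Stated over `Q.FullSubcategory`, which IS `(geometricAutHolFieldFunctor Q).EA`
(`geometric_EA`, `rfl`). [cite: MochizukiAbsTopIII2015, Proposition 4.2 (i) p.106] -/
theorem isIdRigid_mapsTo_of_connectedCover (Q : ObjectProperty HolRS) (hQ : IsCoverClosed Q)
    (X : Q.FullSubcategory)
    (h1 : ∀ a : X.obj ≅ X.obj, (∀ u : X.obj ⟶ X.obj, a.hom ≫ u = u ≫ a.hom) → a.hom = 𝟙 X.obj)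
    (h3 : IsIdRigid (IsConnectedCover X.obj.carrier).FullSubcategory) :
    IsIdRigid (ObjectProperty.FullSubcategory fun Y : Q.FullSubcategory => Nonempty (Y ⟶ X)) := by
  refine isIdRigid_mapsTo_of_over X ?_ ?_
  · -- (H1) inside `Q.FullSubcategory`: automorphisms / endomorphisms of `X` are those of `X.obj`
    intro a ha
    have key := h1 ((ObjectProperty.ι Q).mapIso a) fun u => by
      have hu := congrArg InducedCategory.Hom.hom (ha (ObjectProperty.homMk u))
      simp only [ObjectProperty.FullSubcategory.comp_hom, ObjectProperty.homMk_hom] at hu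
      exact hu
    apply ObjectProperty.hom_ext
    exact key
  · -- (H2): the slice of `Q.FullSubcategory` over `X` ≌ the slice of `HolRS` over `X.obj`
    exact (isIdRigid_iff_of_equivalence_univ (ObjectProperty.overFullSubcategoryEquiv Q hQ X)).2
      (isIdRigid_over_of_isIdRigid_connectedCover X.obj h3)

/-- **`EA^hol_RS(Q)` is id-rigid from the two per-object inputs** — print's «for any object `X` … the
full subcategory … consisting of objects that map to `X` … [is id-rigid]; thus, the id-rigidity of `EA`
follows», with each full subcategory handled by `isIdRigid_mapsTo_of_connectedCover`: for `Q` closed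
under finite étale covers, if for every `𝕏 ∈ Q` (H1) holds at `𝕏` and the connected finite covering
spaces of `𝕏^top` form an id-rigid category, then `EA^hol_RS(Q)` is id-rigid.
[cite: MochizukiAbsTopIII2015, Proposition 4.2 (i) p.106] -/
theorem isIdRigid_EA_of_connectedCovers (Q : ObjectProperty HolRS) (hQ : IsCoverClosed Q)
    (h1 : ∀ X : Q.FullSubcategory, ∀ a : X.obj ≅ X.obj,
      (∀ u : X.obj ⟶ X.obj, a.hom ≫ u = u ≫ a.hom) → a.hom = 𝟙 X.obj)
    (h3 : ∀ X : Q.FullSubcategory, IsIdRigid (IsConnectedCover X.obj.carrier).FullSubcategory) :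
    IsIdRigid (geometricAutHolFieldFunctor Q).EA :=
  isIdRigid_EA_of_forall_isIdRigid_mapsTo Q fun X =>
    isIdRigid_mapsTo_of_connectedCover Q hQ X (h1 X) (h3 X)

/-- **[AbsTopIII] Cor 4.5 over the geometric carriers from the two per-object inputs**: one object of
`EA^hol_RS(Q)` plus (H1) and the id-rigidity of the connected finite covers at every `𝕏 ∈ Q` give
`Cor_4_5` for the archimedean log-Frobenius data over `EA^hol_RS(Q)` (abc-iut-L4-t10's
`cor_4_5_geometric`). [cite: MochizukiAbsTopIII2015, Corollary 4.5 pp.107–109] -/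
theorem cor_4_5_geometric_of_connectedCovers (Q : ObjectProperty HolRS) (hQ : IsCoverClosed Q)
    (X₀ : (geometricAutHolFieldFunctor Q).EA)
    (h1 : ∀ X : Q.FullSubcategory, ∀ a : X.obj ≅ X.obj,
      (∀ u : X.obj ⟶ X.obj, a.hom ≫ u = u ≫ a.hom) → a.hom = 𝟙 X.obj)
    (h3 : ∀ X : Q.FullSubcategory, IsIdRigid (IsConnectedCover X.obj.carrier).FullSubcategory) :
    Literature.AnabelianGeometry.AbsoluteAnabelian.AbsTopIII.Cor_4_5
      (archLogFrobeniusData (geometricAutHolFieldFunctor Q))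
      (archTelecoreData (geometricAutHolFieldFunctor Q)) :=
  cor_4_5_geometric Q X₀ (isIdRigid_EA_of_connectedCovers Q hQ h1 h3)

end HolRS

end Literature.AnabelianGeometry.AbsoluteAnabelian
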